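import Summits.QuantumFields.BalabanUV.T4Continuum.Support.NE9LinSizeEntropy

/-!
# NE9 (node U3, history side) — repair item NE9-F8 «d-CURRENCY DISCHARGERS», part 1b: the Kotecký–Preiss clause,
`DecayExtract` and `PinBudget` in the currency of the linear size, with ADDITIVE rate conditions

Cell `pub-balaban`, T⁴ programme, row NE9; unit `b2b-balaban-t4-ne9-formalise-leaf-05-g2`; repair item NE9-F8 (finding F-ne9leaf01-1,
CLAIMS.log l.6309; claim l.6459; part 2 = the END composition, `…-leaf-10-g2`, l.6537).  Part 1a (`Support/NE9LinSizeEntropy`)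
proved the [II] (1.26)∕(2.29)-TYPE entropy bound IN THE LINEAR SIZE with an additive threshold; THIS FILE turns it into the three
geometry∕entropy binders the END faces of row NE9 display (KP clause of `TwoPointKP` = leaf A1, `DecayExtract` = G1, `PinBudget` =
G2 of `t4/formal/NE9/DAG.md` §1B), read in the currency of `d` = `linSize` instead of the number of cubes:

* weights: KP size function `a(γ) = a₁·#supp γ` (cube currency, as print's `exp 2(LM)⁻⁴|Z|` in [II] (2.40) p.21), decay weight
  `d(γ) = a''·(d(supp γ) + (ν+1))` and extracted decay `δ(X) = a''·(d(cubes X) + (ν+1))` (the «+ν+1» per member is print's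
  «(d_k(Y) + 5)» of (2.27) p.18, `5 = ν + 1` on T⁴);
* §1 the entropy bound of part 1a in family form (`sum_exp_neg_mul_linSize_le_of_family`);
* §2 **`kp_of_linSizeDecay_touch`** — `T4HistoryLipschitzEntropy.kp_of_decay_touch` with the majorant decay read in `d`,
  `m(γ′) ≤ ε·e^{a₀#supp γ′}·e^{−a'·d(supp γ′)}` (`a₀ ≥ 0` an optional per-cube prefactor rate), under the ADDITIVE rate condition
  `2^ν·log 2 + log(8ν) ≤ a' − a'' − 2^ν·(a₁+a₀)` and the smallness `(D+1)·ε·e^{a''(ν+1) + 2^ν(a₁+a₀)}·2^(ν+1+2^ν) ≤ a₁` (NO division of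
  the rate by `2^ν`); and its lift through a support map, **`kpClause_of_linSizeDecay`** (the `hkp` clause of `TwoPointKP`);
* §3 on a cube chart over `(Fin ν → G, adj ⊆ WallAdj)`: **`decayExtract_linSize`** — `DecayExtract δ d` IS (2.27)
  (`T4HistoryLipschitzLinearSize.linSize_biUnion_add_le_sum` BY NAME) under the printed-TYPE hypothesis «the cubes of a domain
  are wall-connected» ([I] p.257); **`pinBudget_linSize`** — `PinBudget a δ (fun _ => a₁·e^{−a''(ν+1)}) κ` under the d-currency
  comparability `κ·C.d X ≤ a''·d(cubes X)` (= `κ ≤ a''` EXACTLY once the carriers read `C.d X = d(cubes X)`, as in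
  `NE9MultiScaleChart.msCarriers`; interface remark of `…-leaf-01`, l.6554): the factor `e^{a''(ν+1)}` (print's `e^{5κ}`, p.18 ∕
  p.21) sits only in the KP smallness, and the envelope `B` that enters the fading product `4·lipbar·B·τ̄` is `a₁·e^{−a''(ν+1)}`;
* §5 non-vacuity: the two scalar side conditions hold jointly at the T⁴ letters `ν = 4`, `D = 8` (two `example`s);
* §4 **`twoPointKP_of_avgExpLinear_linSizeDecay`** ∕ **`twoPointKP_of_avgEvalExpLinear_box_linSizeDecay`** — road P2's
  `T4HistoryLipschitzSegment.twoPointKP_of_avgExpLinear(_box)` fed with §2: `TwoPointKP` with the weights above from the decay of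
  the segment majorant IN THE LINEAR SIZE.

Everything is [folklore] lattice combinatorics ∕ real arithmetic composed with tree theorems BY NAME; no `def`, no END face re-wired
(part 2 plugs §2–§4 into the END faces); the manuscripts under audit are quoted for TYPES only.  HONEST FRAMING: bookkeeping for
rung (B)+1 on a FIXED finite four-torus; it changes the CURRENCY in which three displayed binders of `T4OutputRate.NE9`'s END faces
are discharged (rate conditions additive instead of divided by 2^ν) and says nothing about Bałaban's activities — the (2.38)-TYPE
decay of the configuration-free majorant in `d`, uniformly over admissible tables, stays DISPLAYED (GAPS G-ne9p2-5); NE9 is NOT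
PRINTED and NOT PROVED («NE9 ⇐ the named binders»); 0∕15 leaves instantiated on Bałaban's objects; spine PROVED 0∕9; NOT infinite
volume, NOT a mass gap, NOT Clay.  HONEST DEPENDENCY: continuum YM on T⁴ ⇐ BetaPertH ∧ nine spine estimates (0/9 proved); BetaPertH ⇐
(D1) ∧ (D4) ∧ CAP+tail; G-an2-4 gates asym, D1 and NE2/3/4.

References (TYPES only): [I] = [Balaban1987RG1] CMP 109 (1987) p.257; [II] = [Balaban1988RG2Cluster] CMP 116 (1988) (1.26) p.8,
(2.11)–(2.13) p.14, (2.27), (2.29), (2.30) p.18, (2.38) p.20, (2.39)–(2.41) p.21; [KoteckyPreiss1986] (1)–(3); [FriedliVelenik2017] L.3.38.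
-/

noncomputable section

namespace Summit.QuantumFields.BalabanUV.T4Continuum.NE9LinSizeKP

open scoped BigOperators
open MeasureTheory
open Literature.MathematicalPhysics.QuantumFieldTheory
open Literature.MathematicalPhysics.QuantumFieldTheory.Balaban1983to89
open Literature.MathematicalPhysics.QuantumFieldTheory.Balaban1983to89.T4OutputRate
open Literature.MathematicalPhysics.QuantumFieldTheory.Balaban1983to89.T4ActivityLipschitz
open Literature.MathematicalPhysics.QuantumFieldTheory.Balaban1983to89.T4HistoryLipschitzRecursion
open Literature.MathematicalPhysics.QuantumFieldTheory.Balaban1983to89.T4HistoryLipschitzOuter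
open Literature.MathematicalPhysics.QuantumFieldTheory.Balaban1983to89.T4HistoryLipschitzActivity
open Literature.MathematicalPhysics.QuantumFieldTheory.Balaban1983to89.T4HistoryLipschitzActivity (ClusterGeom)
open Literature.MathematicalPhysics.QuantumFieldTheory.Balaban1983to89.T4HistoryLipschitzEntropy
open Literature.MathematicalPhysics.QuantumFieldTheory.Balaban1983to89.T4HistoryLipschitzCubeGeometry
open Literature.MathematicalPhysics.QuantumFieldTheory.Balaban1983to89.T4HistoryLipschitzSegment
open Literature.MathematicalPhysics.QuantumFieldTheory.Balaban1983to89.T4HistoryLipschitzLinearSize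
open Summit.QuantumFields.BalabanUV.T4Continuum.NE9LinSizeEntropy

variable {ν : ℕ} {G : Type*} [AddCommGroup G] [One G] [DecidableEq G]

/-! ## §1 The entropy bound of part 1a over an arbitrary sub-family (instance-free form) -/

/-- **entropy bound, family form**: for a finite family `𝓕` of cube families inside `Λ`, each containing `x` and having a lattice
skeleton, `Σ_{X ∈ 𝓕} e^{−κ·d(X)} ≤ 2^(ν+1+2^ν)` for `κ ≥ 2^ν·log 2 + log(8ν)`. [cite: Balaban1988RG2Cluster, (1.26) p.8 and (2.29) p.18] -/
theorem sum_exp_neg_mul_linSize_le_of_family (Λ : Finset (Fin ν → G)) (x : Fin ν → G) {𝓕 : Finset (Finset (Fin ν → G))}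
    (h𝓕 : ∀ X ∈ 𝓕, X ⊆ Λ ∧ x ∈ X ∧ ∃ S, IsSkeleton X S) {κ : ℝ}
    (hκ : (2:ℝ) ^ ν * Real.log 2 + Real.log (8 * ν) ≤ κ) :
    ∑ X ∈ 𝓕, Real.exp (-(κ * (linSize X : ℝ))) ≤ (2:ℝ) ^ (ν + 1 + 2 ^ ν) := by
  classical
  refine le_trans (Finset.sum_le_sum_of_subset_of_nonneg (fun X hX => ?_) fun _ _ _ => Real.exp_nonneg _)
    (sum_exp_neg_mul_linSize_le_const Λ x hκ)
  obtain ⟨h1, h2, h3⟩ := h𝓕 X hX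
  exact Finset.mem_filter.2 ⟨Finset.mem_powerset.2 h1, h2, h3⟩

/-! ## §2 The Kotecký–Preiss clause from decay IN THE LINEAR SIZE (touch form; additive rate condition) -/

/-- **KOTECKÝ–PREISS FROM DECAY IN THE LINEAR SIZE AND ENTROPY — TOUCH FORM (kernel; abstract).**  The telescope of
`T4HistoryLipschitzEntropy.kp_of_decay_touch` (polymers `γ′ ∈ L` with pairwise distinct supports `supp γ′ ⊆ Λ ⊆ Fin ν → G`,
connected for an adjacency `adj ⊆ WallAdj` of degree `≤ D`; incompatibility ⇒ a common or adjacent cube), with the majorant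
decay read in the linear size with an optional per-cube prefactor rate `a₀ ≥ 0`, `m(γ′) ≤ ε·e^{a₀·#supp γ′}·e^{−a'·d(supp γ′)}`
([II] Lemma 3 (2.38) p.20 TYPE; `a₀` absorbs polynomial volume factors such as `1 + #γ′ ≤ 2^{#γ′}`), the size weights `a₁·#supp`
and the decay weights `a''·(d(supp) + (ν+1))`.  If `2^ν·log 2 + log(8ν) ≤ a' − a'' − 2^ν·(a₁ + a₀)` (ADDITIVE: the per-cube rates
cost `2^ν·(a₁ + a₀)` through `#X ≤ 2^ν(d(X)+1)`, the decay weights cost `a''`, the entropy costs the threshold of part 1a) and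
`(D+1)·ε·e^{a''(ν+1) + 2^ν(a₁+a₀)}·2^(ν+1+2^ν) ≤ a₁`, then
`Σ_{γ′ ∈ L, γ′ ι γ} m(γ′)·e^{a₁#supp γ′ + a''(d(supp γ′)+ν+1)} ≤ a₁·#supp γ`.  Proof: termwise
`m·e^{…} ≤ ε·e^{a''(ν+1)+2^ν(a₁+a₀)}·e^{−(a'−a''−2^ν(a₁+a₀))·d}`, part 1a at each cube of the closed neighbourhood of `supp γ`, union
bound.
[cite: KoteckyPreiss1986, (1)-(3); Balaban1988RG2Cluster, (1.26) p.8, Lemma 3 (2.38) p.20 and (2.39)-(2.41) p.21] -/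
theorem kp_of_linSizeDecay_touch {P : Type*} {inc : P → P → Prop} [DecidableRel inc]
    (adj : (Fin ν → G) → (Fin ν → G) → Prop) [DecidableRel adj] (D : ℕ)
    (hD : ∀ (a : Fin ν → G) (Q : Finset (Fin ν → G)), (Q.filter (adj a)).card ≤ D)
    (hadjW : ∀ x y, adj x y → WallAdj x y)
    {L : Finset P} {supp : P → Finset (Fin ν → G)} {Λ : Finset (Fin ν → G)} (hsub : ∀ γ' ∈ L, supp γ' ⊆ Λ)
    (hconn : ∀ γ' ∈ L, ∃ a ∈ supp γ', Polymer.IsConn adj (supp γ') a) (hinj : Set.InjOn supp L)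
    (htouch : ∀ γ' ∈ L, ∀ γ, inc γ' γ → ∃ x ∈ supp γ, ∃ x' ∈ supp γ', x' = x ∨ adj x x')
    {m : P → ℝ} {ε a' a'' a₁ a₀ : ℝ} (hε : 0 ≤ ε) (hm0 : ∀ γ', 0 ≤ m γ')
    (hm : ∀ γ' ∈ L, m γ' ≤ ε * Real.exp (a₀ * (supp γ').card) * Real.exp (-(a' * (linSize (supp γ') : ℝ))))
    (ha₁ : 0 ≤ a₁) (ha₀ : 0 ≤ a₀)
    (hrate : (2:ℝ) ^ ν * Real.log 2 + Real.log (8 * ν) ≤ a' - a'' - 2 ^ ν * (a₁ + a₀))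
    (hsmall : ((D : ℝ) + 1) * ε * Real.exp (a'' * (ν + 1) + 2 ^ ν * (a₁ + a₀)) * 2 ^ (ν + 1 + 2 ^ ν) ≤ a₁) (γ : P) :
    ∑ γ' ∈ L with inc γ' γ, m γ' * Real.exp (a₁ * (supp γ').card + a'' * ((linSize (supp γ') : ℝ) + (ν + 1))) ≤
      a₁ * (supp γ).card := by
  classical
  set f : P → ℝ := fun γ' => m γ' * Real.exp (a₁ * (supp γ').card + a'' * ((linSize (supp γ') : ℝ) + (ν + 1))) with hf
  have hnn : ∀ γ', 0 ≤ f γ' := fun γ' => mul_nonneg (hm0 γ') (Real.exp_nonneg _)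
  set κ : ℝ := a' - a'' - 2 ^ ν * (a₁ + a₀) with hκ
  set c : ℝ := ε * Real.exp (a'' * (ν + 1) + 2 ^ ν * (a₁ + a₀)) with hc
  have hc0 : 0 ≤ c := by positivity
  set K : ℝ := (2:ℝ) ^ (ν + 1 + 2 ^ ν) with hK
  -- every support has a lattice skeleton (it is `adj`-, hence wall-connected)
  have hsk : ∀ γ' ∈ L, ∃ S, IsSkeleton (supp γ') S := by
    intro γ' hγ'
    obtain ⟨a, _, ha⟩ := hconn γ' hγ'
    exact ⟨_, isSkeleton_self_of_isConn (isConn_mono_rel (fun x _ y _ h => hadjW x y h) ha)⟩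
  -- termwise: `f γ' ≤ c·e^{−κ·d(supp γ')}`
  have hterm : ∀ γ' ∈ L, f γ' ≤ c * Real.exp (-(κ * (linSize (supp γ') : ℝ))) := by
    intro γ' hγ'
    have hcard : ((supp γ').card : ℝ) ≤ 2 ^ ν * ((linSize (supp γ') : ℝ) + 1) := by
      exact_mod_cast card_le_two_pow_mul_linSize_succ (hsk γ' hγ')
    have hE : (a₀ * (supp γ').card + -(a' * (linSize (supp γ') : ℝ))) +
          (a₁ * (supp γ').card + a'' * ((linSize (supp γ') : ℝ) + (ν + 1))) ≤
        (a'' * (ν + 1) + 2 ^ ν * (a₁ + a₀)) + -(κ * (linSize (supp γ') : ℝ)) := by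
      have := mul_le_mul_of_nonneg_left hcard (add_nonneg ha₁ ha₀)
      rw [hκ]; nlinarith
    have hm' : m γ' ≤ ε * Real.exp (a₀ * (supp γ').card + -(a' * (linSize (supp γ') : ℝ))) := by
      rw [Real.exp_add, ← mul_assoc]; exact hm γ' hγ'
    calc f γ' ≤ ε * Real.exp (a₀ * (supp γ').card + -(a' * (linSize (supp γ') : ℝ))) *
          Real.exp (a₁ * (supp γ').card + a'' * ((linSize (supp γ') : ℝ) + (ν + 1))) :=
          mul_le_mul_of_nonneg_right hm' (Real.exp_nonneg _)
      _ = ε * Real.exp ((a₀ * (supp γ').card + -(a' * (linSize (supp γ') : ℝ))) +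
          (a₁ * (supp γ').card + a'' * ((linSize (supp γ') : ℝ) + (ν + 1)))) := by rw [mul_assoc, ← Real.exp_add]
      _ ≤ ε * Real.exp ((a'' * (ν + 1) + 2 ^ ν * (a₁ + a₀)) + -(κ * (linSize (supp γ') : ℝ))) :=
          mul_le_mul_of_nonneg_left (Real.exp_le_exp.2 hE) hε
      _ = c * Real.exp (-(κ * (linSize (supp γ') : ℝ))) := by rw [Real.exp_add, ← mul_assoc]
  -- at each cube: the polymers of `L` through `x'`, injected by `supp`, summed by part 1a
  have hsite : ∀ x, ∑ γ' ∈ L.filter (fun γ' => x ∈ supp γ'), f γ' ≤ c * K := by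
    intro x
    have hfam : ∀ X ∈ (L.filter fun γ' => x ∈ supp γ').image supp, X ⊆ Λ ∧ x ∈ X ∧ ∃ S, IsSkeleton X S := by
      intro X hX
      obtain ⟨γ', hγ', rfl⟩ := Finset.mem_image.1 hX
      obtain ⟨hL, hxγ'⟩ := Finset.mem_filter.1 hγ'
      exact ⟨hsub γ' hL, hxγ', hsk γ' hL⟩
    calc ∑ γ' ∈ L.filter (fun γ' => x ∈ supp γ'), f γ'
        ≤ ∑ γ' ∈ L.filter (fun γ' => x ∈ supp γ'), c * Real.exp (-(κ * (linSize (supp γ') : ℝ))) :=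
          Finset.sum_le_sum fun γ' hγ' => hterm γ' (Finset.mem_filter.1 hγ').1
      _ = ∑ X ∈ (L.filter fun γ' => x ∈ supp γ').image supp, c * Real.exp (-(κ * (linSize X : ℝ))) := by
          rw [Finset.sum_image]
          exact fun γ₁ h₁ γ₂ h₂ he => hinj (Finset.mem_filter.1 h₁).1 (Finset.mem_filter.1 h₂).1 he
      _ = c * ∑ X ∈ (L.filter fun γ' => x ∈ supp γ').image supp, Real.exp (-(κ * (linSize X : ℝ))) := by
          rw [Finset.mul_sum]
      _ ≤ c * K := mul_le_mul_of_nonneg_left (sum_exp_neg_mul_linSize_le_of_family Λ x hfam hrate) hc0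
  -- closed neighbourhoods of the cubes of `supp γ`
  set nb : (Fin ν → G) → Finset (Fin ν → G) := fun x => insert x (Λ.filter (adj x)) with hnb
  have hnb_card : ∀ x, ((nb x).card : ℝ) ≤ D + 1 := by
    intro x
    have h1 : (nb x).card ≤ (Λ.filter (adj x)).card + 1 := Finset.card_insert_le _ _
    have h2 := hD x Λ
    exact_mod_cast h1.trans (by omega)
  have hcover : L.filter (fun γ' => inc γ' γ) ⊆
      (supp γ).biUnion fun x => (nb x).biUnion fun x' => L.filter fun γ' => x' ∈ supp γ' := by
    intro γ' hγ'
    obtain ⟨hL, hi⟩ := Finset.mem_filter.1 hγ'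
    obtain ⟨x, hx, x', hx', hxx'⟩ := htouch γ' hL γ hi
    refine Finset.mem_biUnion.2 ⟨x, hx, Finset.mem_biUnion.2 ⟨x', ?_, Finset.mem_filter.2 ⟨hL, hx'⟩⟩⟩
    rcases hxx' with rfl | hadj
    · exact Finset.mem_insert_self _ _
    · exact Finset.mem_insert_of_mem (Finset.mem_filter.2 ⟨hsub γ' hL hx', hadj⟩)
  have hcK0 : 0 ≤ c * K := by positivity
  have hfinal : ((D : ℝ) + 1) * (c * K) ≤ a₁ := by
    calc ((D : ℝ) + 1) * (c * K)
        = ((D : ℝ) + 1) * ε * Real.exp (a'' * (ν + 1) + 2 ^ ν * (a₁ + a₀)) * 2 ^ (ν + 1 + 2 ^ ν) := by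
          rw [hc, hK]; ring
      _ ≤ a₁ := hsmall
  calc ∑ γ' ∈ L with inc γ' γ, f γ'
      ≤ ∑ γ' ∈ (supp γ).biUnion (fun x => (nb x).biUnion fun x' => L.filter fun γ' => x' ∈ supp γ'), f γ' :=
        Finset.sum_le_sum_of_subset_of_nonneg hcover fun γ' _ _ => hnn γ'
    _ ≤ ∑ x ∈ supp γ, ∑ γ' ∈ (nb x).biUnion (fun x' => L.filter fun γ' => x' ∈ supp γ'), f γ' :=
        Polymer.sum_biUnion_le_sum (supp γ) _ f hnn
    _ ≤ ∑ x ∈ supp γ, ∑ x' ∈ nb x, ∑ γ' ∈ L.filter (fun γ' => x' ∈ supp γ'), f γ' :=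
        Finset.sum_le_sum fun x _ => Polymer.sum_biUnion_le_sum (nb x) _ f hnn
    _ ≤ ∑ x ∈ supp γ, ∑ x' ∈ nb x, c * K :=
        Finset.sum_le_sum fun x _ => Finset.sum_le_sum fun x' _ => hsite x'
    _ = ∑ x ∈ supp γ, ((nb x).card : ℝ) * (c * K) := by
        refine Finset.sum_congr rfl fun x _ => ?_
        rw [Finset.sum_const, nsmul_eq_mul]
    _ ≤ ∑ x ∈ supp γ, ((D : ℝ) + 1) * (c * K) :=
        Finset.sum_le_sum fun x _ => mul_le_mul_of_nonneg_right (hnb_card x) hcK0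
    _ = ((D : ℝ) + 1) * (c * K) * (supp γ).card := by
        rw [Finset.sum_const, nsmul_eq_mul]; ring
    _ ≤ a₁ * (supp γ).card := mul_le_mul_of_nonneg_right hfinal (Nat.cast_nonneg _)

/-! ## §2b Lift through a support map: the `hkp` clause of `TwoPointKP` ∕ POTENTIAL-KP in the currency of `d` -/

section SupportMap

variable {C : Carriers} {Gm : ClusterGeom C} {Bg : Type} {adj : (Fin ν → G) → (Fin ν → G) → Prop} [DecidableRel adj]
  {D : ℕ}

/-- **THE `hkp` CLAUSE FROM DECAY IN THE LINEAR SIZE (kernel).**  Under a support map `S : Supported Gm (Fin ν → G) adj D` with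
`adj ⊆ WallAdj`, a nonnegative majorant `M` with `M k (g k) U γ′ ≤ ε k·e^{a₀·#supp γ′}·e^{−a'·d(supp γ′)}` on every step volume at the
occurring couplings (`a₀ ≥ 0` an optional per-cube prefactor rate), the additive rate condition
`2^ν·log 2 + log(8ν) ≤ a' − a'' − 2^ν·(a₁ + a₀)` and the smallness `(D+1)·ε k·e^{a''(ν+1)+2^ν(a₁+a₀)}·2^(ν+1+2^ν) ≤ a₁` give the
Kotecký–Preiss clause with the weights `a = S.sizeWeight a₁`,
`d = fun γ => a''·(d(supp γ) + (ν+1))` — `T4HistoryLipschitzEntropy.Supported.kpClause_of_decay` in the currency of `d`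
(∘ `kp_of_linSizeDecay_touch`). [cite: KoteckyPreiss1986, (1)-(3); Balaban1988RG2Cluster, Lemma 3 (2.38) p.20 and (2.39)-(2.41) p.21] -/
theorem kpClause_of_linSizeDecay (S : Supported Gm (Fin ν → G) adj D) (hadjW : ∀ x y, adj x y → WallAdj x y)
    {W : Set (ℕ → ℝ)} {M : ℕ → ℝ → Bg → Gm.P → ℝ} {ε : ℕ → ℝ} {a' a'' a₁ a₀ : ℝ} (hε : ∀ k, 0 ≤ ε k)
    (hM0 : ∀ k s U γ', 0 ≤ M k s U γ')
    (hdec : ∀ g ∈ W, ∀ (k : ℕ) (U : Bg) (X : C.Dom), C.scale X = k + 1 → ∀ γ' ∈ Gm.vol X,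
      M k (g k) U γ' ≤ ε k * Real.exp (a₀ * (S.supp γ').card) * Real.exp (-(a' * (linSize (S.supp γ') : ℝ))))
    (ha₁ : 0 ≤ a₁) (ha₀ : 0 ≤ a₀)
    (hrate : (2:ℝ) ^ ν * Real.log 2 + Real.log (8 * ν) ≤ a' - a'' - 2 ^ ν * (a₁ + a₀))
    (hsmall : ∀ k, ((D : ℝ) + 1) * ε k * Real.exp (a'' * (ν + 1) + 2 ^ ν * (a₁ + a₀)) * 2 ^ (ν + 1 + 2 ^ ν) ≤ a₁) :
    ∀ g ∈ W, ∀ (k : ℕ) (U : Bg) (X : C.Dom), C.scale X = k + 1 → ∀ γ ∈ Gm.vol X,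
      ∑ γ' ∈ Gm.vol X with Gm.inc γ' γ,
        M k (g k) U γ' * Real.exp (S.sizeWeight a₁ γ' + a'' * ((linSize (S.supp γ') : ℝ) + (ν + 1))) ≤
        S.sizeWeight a₁ γ := by
  classical
  intro g hg k U X hX γ _
  exact kp_of_linSizeDecay_touch (inc := Gm.inc) adj D S.deg hadjW (S.sub X) (S.conn X) (S.inj X) (S.touch X) (hε k)
    (hM0 k (g k) U) (hdec g hg k U X hX) ha₁ ha₀ hrate (hsmall k) γ

end SupportMap

/-! ## §3 The geometry binders of a cube chart in the currency of `d`: `DecayExtract` = (2.27), `PinBudget` with the envelope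
`a₁·e^{−a''(ν+1)}` -/

section Chart

-- `CubeChart` takes its site type in `Type`: a coordinate group `G₀ : Type` (e.g. the torus `ZMod N`)
variable {G₀ : Type} [AddCommGroup G₀] [One G₀] [DecidableEq G₀]
variable {C : Carriers} {adj : (Fin ν → G₀) → (Fin ν → G₀) → Prop} [DecidableRel adj] [Std.Symm adj] {D : ℕ}

/-- **`DecayExtract` IN THE LINEAR SIZE IS (2.27) (kernel).**  On a cube chart whose domains have WALL-CONNECTED cube families
([I] p.257 «Such a domain is a union of a connected, finite family of cubes») and whose adjacency refines the wall adjacency, the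
decay weights `a''·(d(γ) + (ν+1))` extract `a''·(d(cubes X) + (ν+1))` from every localizing family of `X` — [II] (2.27) p.18
«Σ_{Y∈𝐃}(d_k(Y) + 5) ≥ d_k(Y₀) + 5», in the tree as `T4HistoryLipschitzLinearSize.linSize_biUnion_add_le_sum` (constant `ν + 1`).
[cite: Balaban1988RG2Cluster, (2.27) p.18 and (2.13) p.14; Balaban1987RG1, p.257] -/
theorem decayExtract_linSize (Γ : CubeChart C (Fin ν → G₀) adj D) (hadjW : ∀ x y, adj x y → WallAdj x y) {a'' : ℝ}
    (ha'' : 0 ≤ a'') (hXconn : ∀ X, ∃ a, Polymer.IsConn WallAdj (Γ.cubes X) a) :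
    Γ.geom.DecayExtract (fun X => a'' * ((linSize (Γ.cubes X) : ℝ) + (ν + 1)))
      (fun γ => a'' * ((linSize (Γ.supported.supp γ) : ℝ) + (ν + 1))) := by
  intro X K hK
  obtain ⟨hKvol, hU⟩ := Γ.mem_clus.1 hK
  have hY : ∀ Y ∈ K, Y.Nonempty := fun Y hY => nonempty_of_mem_connFamilies (hKvol hY)
  have hsk : ∀ Y ∈ K, ∃ S, IsSkeleton Y S := by
    intro Y hY
    obtain ⟨-, a, _, ha⟩ := Γ.mem_vol.1 (hKvol hY)
    exact ⟨Y, isSkeleton_self_of_isConn (isConn_mono_rel (fun x _ y _ h => hadjW x y h) ha)⟩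
  have hne : K.Nonempty := by
    obtain ⟨c, hc⟩ := Γ.cubes_nonempty X
    rw [← hU] at hc
    obtain ⟨Y, hY, -⟩ := Finset.mem_biUnion.1 hc
    exact ⟨Y, hY⟩
  obtain ⟨a, ha⟩ := hXconn X
  rw [← hU] at ha
  have h := linSize_biUnion_add_le_sum hne hsk hY ha
  rw [hU] at h
  have h' : (linSize (Γ.cubes X) : ℝ) + (ν + 1) ≤ ∑ Y ∈ K, ((linSize Y : ℝ) + (ν + 1)) := by exact_mod_cast h
  calc a'' * ((linSize (Γ.cubes X) : ℝ) + (ν + 1))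
      ≤ a'' * ∑ Y ∈ K, ((linSize Y : ℝ) + (ν + 1)) := mul_le_mul_of_nonneg_left h' ha''
    _ = ∑ Y ∈ K, a'' * ((linSize (Γ.supported.supp Y) : ℝ) + (ν + 1)) := by rw [Finset.mul_sum]; rfl

/-- **`PinBudget` IN THE LINEAR SIZE (kernel).**  With the size weights `a₁·#cubes` (the pin is ONE cube), the decay weights of
§3 and the d-currency comparability `κ·C.d X ≤ a''·d(cubes X)` (`κ ≤ a''` EXACTLY when the carriers read `C.d X = d(cubes X)`), the
pin budget holds with the CONSTANT envelope `B = a₁·e^{−a''(ν+1)}`: `a₁·e^{−a''(d + ν + 1)} ≤ a₁·e^{−a''(ν+1)}·e^{−κ·C.d X}` — the shape of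
[II] (2.40)→(2.41) p.21 with no volume factor to absorb. [cite: Balaban1988RG2Cluster, (2.40)-(2.41) p.21 and (2.30) p.18] -/
theorem pinBudget_linSize (Γ : CubeChart C (Fin ν → G₀) adj D) {a₁ a'' κ : ℝ} (ha₁ : 0 ≤ a₁)
    (hcmp : ∀ X, κ * C.d X ≤ a'' * (linSize (Γ.cubes X) : ℝ)) :
    Γ.geom.PinBudget (Γ.supported.sizeWeight a₁) (fun X => a'' * ((linSize (Γ.cubes X) : ℝ) + (ν + 1)))
      (fun _ => a₁ * Real.exp (-(a'' * (ν + 1)))) κ := by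
  intro k X _
  have hpin : Γ.supported.sizeWeight a₁ (Γ.geom.pin X) = a₁ := by
    simp [Supported.sizeWeight]
  rw [hpin, mul_assoc, ← Real.exp_add]
  exact mul_le_mul_of_nonneg_left (Real.exp_le_exp.2 (by nlinarith [hcmp X])) ha₁

/-- **the torus chart case**: `torusAdj ν N` IS `WallAdj` on `Fin ν → ZMod N` (`wallAdj_eq_torusAdj`, by `rfl`), so on the cube
charts of E2∕E5 (`CubeChart C (Fin ν → ZMod N) (torusAdj ν N) D`) the refinement hypothesis `hadjW` is the identity and a
`torusAdj`-connectedness hypothesis is accepted where `WallAdj` is displayed. [folklore] -/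
example {N : ℕ} (Γ : CubeChart C (Fin ν → ZMod N) (torusAdj ν N) D) {a'' : ℝ} (ha'' : 0 ≤ a'')
    (hXconn : ∀ X, ∃ a, Polymer.IsConn (torusAdj ν N) (Γ.cubes X) a) :
    Γ.geom.DecayExtract (fun X => a'' * ((linSize (Γ.cubes X) : ℝ) + (ν + 1)))
      (fun γ => a'' * ((linSize (Γ.supported.supp γ) : ℝ) + (ν + 1))) :=
  decayExtract_linSize Γ (fun _ _ h => h) ha'' hXconn

end Chart

/-! ## §4 `TwoPointKP` for averaged exp-linear ∕ exp-evaluation activities from decay of the segment majorant IN THE LINEAR SIZE -/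

section TwoPoint

variable {C : Carriers} {Gm : ClusterGeom C} {Bg : Type} {adj : (Fin ν → G) → (Fin ν → G) → Prop} [DecidableRel adj]
  {D : ℕ}
variable {Pot : Type*} [NormedAddCommGroup Pot] [NormedSpace ℂ Pot] {Ω : Type*} [MeasurableSpace Ω]

/-- **TWO-POINT KP FROM DECAY OF THE SEGMENT MAJORANT IN THE LINEAR SIZE (kernel).**
`T4HistoryLipschitzSegment.twoPointKP_of_avgExpLinear_decay` with the decay hypothesis `segMajorant ≤ ε k·e^{−a'·d(supp γ′)}` and the
additive conditions of §2 (the factor `2` of `2·segMajorant` inside the smallness); weights `S.sizeWeight a₁` and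
`a''·(d(supp γ) + (ν+1))`.  DISPLAYED: the decay bound — print's (2.26) p.17 → Lemma 3 (2.38) p.20 TYPE for ONE table, its uniformity
over the admissible set NOT PRINTED (GAPS G-ne9p2-5). [cite: Balaban1988RG2Cluster, (2.26) p.17, (2.37)-(2.41) pp.20-21; KoteckyPreiss1986, (1)-(3)] -/
theorem twoPointKP_of_avgExpLinear_linSizeDecay (S : Supported Gm (Fin ν → G) adj D) (hadjW : ∀ x y, adj x y → WallAdj x y)
    {W : Set (ℕ → ℝ)} {μ : ℕ → ℝ → Bg → Gm.P → Measure Ω} {pre : ℕ → ℝ → Bg → Gm.P → Ω → ℂ}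
    {lin : ℕ → ℝ → Bg → Gm.P → Ω → (Pot →L[ℂ] ℂ)} {l e : ℕ → ℝ → Bg → Gm.P → Ω → ℝ} {lip : ℕ → ℝ} {𝒜 : ℕ → Set Pot}
    {ε : ℕ → ℝ} {a' a'' a₁ : ℝ} (ha₁ : 0 ≤ a₁) (ha'' : 0 ≤ a'') (hlip : ∀ k, 0 < lip k)
    (hpre : ∀ k s U γ, AEStronglyMeasurable (pre k s U γ) (μ k s U γ))
    (hlinw : ∀ k s U γ (Q : Pot), AEStronglyMeasurable (fun ω => lin k s U γ ω Q) (μ k s U γ))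
    (hl : ∀ k s U γ ω, ‖lin k s U γ ω‖ ≤ l k s U γ ω)
    (he : ∀ k s U γ, ∀ Q ∈ 𝒜 k, ∀ ω, (lin k s U γ ω Q).re ≤ e k s U γ ω)
    (hint₀ : ∀ k s U γ, Integrable (fun ω => ‖pre k s U γ ω‖ * Real.exp (e k s U γ ω)) (μ k s U γ))
    (hint₁ : ∀ k s U γ, Integrable (fun ω => ‖pre k s U γ ω‖ * l k s U γ ω * Real.exp (e k s U γ ω)) (μ k s U γ))
    (hε : ∀ k, 0 ≤ ε k)
    (hdecay : ∀ g ∈ W, ∀ (k : ℕ) (U : Bg) (X : C.Dom), C.scale X = k + 1 → ∀ γ' ∈ Gm.vol X,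
      segMajorant μ pre l e lip k (g k) U γ' ≤ ε k * Real.exp (-(a' * (linSize (S.supp γ') : ℝ))))
    (hrate : (2:ℝ) ^ ν * Real.log 2 + Real.log (8 * ν) ≤ a' - a'' - 2 ^ ν * a₁)
    (hsmall : ∀ k, 2 * (((D : ℝ) + 1) * ε k * Real.exp (a'' * (ν + 1) + 2 ^ ν * a₁) * 2 ^ (ν + 1 + 2 ^ ν)) ≤ a₁) :
    TwoPointKP Gm W (Gm.avgExpLinearAct μ pre lin) 𝒜 (segMajorant μ pre l e lip) lip (S.sizeWeight a₁)
      (fun γ => a'' * ((linSize (S.supp γ) : ℝ) + (ν + 1))) := by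
  have hl0 : ∀ k s U γ ω, 0 ≤ l k s U γ ω := fun k s U γ ω => (norm_nonneg _).trans (hl k s U γ ω)
  have hkp := kpClause_of_linSizeDecay S hadjW (W := W) (M := fun k s U γ => 2 * segMajorant μ pre l e lip k s U γ)
    (ε := fun k => 2 * ε k) (a₀ := 0) (fun k => by have := hε k; positivity)
    (fun k s U γ' => mul_nonneg (by norm_num) (segMajorant_nonneg μ pre e hl0 (fun k => (hlip k).le) k s U γ'))
    (fun g hg k U X hX γ' hγ' => by
      have h := hdecay g hg k U X hX γ' hγ'
      show 2 * segMajorant μ pre l e lip k (g k) U γ' ≤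
        2 * ε k * Real.exp (0 * ((S.supp γ').card : ℝ)) * Real.exp (-(a' * (linSize (S.supp γ') : ℝ)))
      rw [zero_mul, Real.exp_zero, mul_one]
      nlinarith [Real.exp_nonneg (-(a' * (linSize (S.supp γ') : ℝ)))])
    ha₁ le_rfl (by rw [add_zero]; exact hrate) (fun k => by rw [add_zero]; have := hsmall k; nlinarith [hε k])
  exact twoPointKP_of_avgExpLinear Gm (S.sizeWeight_nonneg ha₁) (fun γ => by positivity) hlip hpre hlinw hl he hint₀
    hint₁ hkp

open BoundedContinuousFunction in
/-- **TWO-POINT KP ON A BOX FROM DECAY IN THE LINEAR SIZE (kernel).**  The box instance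
(`T4HistoryLipschitzSegment.twoPointKP_of_avgEvalExpLinear_box`): activities `T ↦ ∫ pre·exp(Σ_Y c_ω(Y)·T(pt_ω(Y))) dμ` on the table
space `Sp →ᵇ ℂ`, boxes `boxSet (β k)`, segment majorant from `coeffSum` ∕ `boxExponent`; the KP clause from §2 with the decay of the
segment majorant in the linear size.  This is the `hK : TwoPointKP …` binder of the NE9 END faces (leaf A1) in the currency of `d`.
[cite: Balaban1988RG2Cluster, (2.26) p.17, (2.37)-(2.41) pp.20-21; KoteckyPreiss1986, (1)-(3)] -/
theorem twoPointKP_of_avgEvalExpLinear_box_linSizeDecay {Sp : Type*} [TopologicalSpace Sp] [MeasurableSpace Sp]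
    [OpensMeasurableSpace Sp] {F : Type*} [Fintype F]
    (S : Supported Gm (Fin ν → G) adj D) (hadjW : ∀ x y, adj x y → WallAdj x y) {W : Set (ℕ → ℝ)}
    {μ : ℕ → ℝ → Bg → Gm.P → Measure Ω} {pre : ℕ → ℝ → Bg → Gm.P → Ω → ℂ} {c : ℕ → ℝ → Bg → Gm.P → Ω → F → ℂ}
    {pt : ℕ → ℝ → Bg → Gm.P → Ω → F → Sp} {β : ℕ → Sp → ℝ} {lip ε : ℕ → ℝ} {a' a'' a₁ : ℝ} (ha₁ : 0 ≤ a₁)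
    (ha'' : 0 ≤ a'') (hlip : ∀ k, 0 < lip k) (hpre : ∀ k s U γ, AEStronglyMeasurable (pre k s U γ) (μ k s U γ))
    (hc : ∀ k s U γ Y, AEStronglyMeasurable (fun ω => c k s U γ ω Y) (μ k s U γ))
    (hpt : ∀ k s U γ Y, Measurable fun ω => pt k s U γ ω Y)
    (hint₀ : ∀ k s U γ, Integrable (fun ω => ‖pre k s U γ ω‖ * Real.exp (boxExponent c pt β k s U γ ω)) (μ k s U γ))
    (hint₁ : ∀ k s U γ, Integrable
      (fun ω => ‖pre k s U γ ω‖ * coeffSum c k s U γ ω * Real.exp (boxExponent c pt β k s U γ ω)) (μ k s U γ))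
    (hε : ∀ k, 0 ≤ ε k)
    (hdecay : ∀ g ∈ W, ∀ (k : ℕ) (U : Bg) (X : C.Dom), C.scale X = k + 1 → ∀ γ' ∈ Gm.vol X,
      segMajorant μ pre (coeffSum c) (boxExponent c pt β) lip k (g k) U γ' ≤
        ε k * Real.exp (-(a' * (linSize (S.supp γ') : ℝ))))
    (hrate : (2:ℝ) ^ ν * Real.log 2 + Real.log (8 * ν) ≤ a' - a'' - 2 ^ ν * a₁)
    (hsmall : ∀ k, 2 * (((D : ℝ) + 1) * ε k * Real.exp (a'' * (ν + 1) + 2 ^ ν * a₁) * 2 ^ (ν + 1 + 2 ^ ν)) ≤ a₁) :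
    TwoPointKP Gm W (Gm.avgExpLinearAct μ pre fun k s U γ ω => evalFunctional (c k s U γ ω) (pt k s U γ ω))
      (fun k => boxSet (β k)) (segMajorant μ pre (coeffSum c) (boxExponent c pt β) lip) lip (S.sizeWeight a₁)
      (fun γ => a'' * ((linSize (S.supp γ) : ℝ) + (ν + 1))) :=
  twoPointKP_of_avgExpLinear_linSizeDecay S hadjW ha₁ ha'' hlip hpre
    (fun k s U γ Q => aestronglyMeasurable_evalFunctional_apply (hc k s U γ) (hpt k s U γ) Q)
    (fun _ _ _ _ _ => norm_evalFunctional_le _ _) (fun _ _ _ _ _ hQ _ => re_evalFunctional_le_of_mem_boxSet hQ)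
    hint₀ hint₁ hε hdecay hrate hsmall

end TwoPoint

/-! ## §5 Non-vacuity of the two scalar side conditions at the T⁴ letters `ν = 4`, `D = 2ν = 8`

The additive rate condition and the smallness are JOINTLY satisfiable with a positive decay scale: e.g. `a' = 17`, `a'' = 1`,
`a₁ = 1∕16` (so `2^ν·a₁ = 1`), `ε = 10⁻¹²` — `21·log 2 < 15` and `2·9·10⁻¹²·e⁶·2²¹ ≤ 1∕16`.  Illustration only: the letters of an
instantiation come from its own (2.38)-TYPE decay bound; nothing about Bałaban's constants is claimed. -/

/-- the additive rate condition of §2 holds at `ν = 4`, `a' = 17`, `a'' = 1`, `a₁ = 1∕16`. [folklore] -/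
example : (2:ℝ) ^ (4:ℕ) * Real.log 2 + Real.log (8 * ((4:ℕ) : ℝ)) ≤ 17 - 1 - 2 ^ (4:ℕ) * (1 / 16 : ℝ) := by
  have hlog2 := Real.log_two_lt_d9
  have h32 : Real.log (8 * ((4:ℕ) : ℝ)) = (5:ℕ) * Real.log 2 := by
    rw [← Real.log_pow]; norm_num
  rw [h32]; push_cast; nlinarith

/-- the smallness of §4 (with the factor `2` of `2·segMajorant`) holds at `ν = 4`, `D = 8`, `a'' = 1`, `a₁ = 1∕16`, `ε = 10⁻¹²`.
[folklore] -/
example : 2 * ((((8:ℕ) : ℝ) + 1) * (1e-12 : ℝ) * Real.exp (1 * (((4:ℕ) : ℝ) + 1) + 2 ^ (4:ℕ) * (1 / 16 : ℝ)) *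
    2 ^ ((4:ℕ) + 1 + 2 ^ (4:ℕ))) ≤ 1 / 16 := by
  have h6 : Real.exp (1 * (((4:ℕ) : ℝ) + 1) + 2 ^ (4:ℕ) * (1 / 16 : ℝ)) = Real.exp 1 ^ 6 := by
    rw [← Real.exp_nat_mul]; norm_num
  rw [h6]; have he := Real.exp_one_lt_d9
  have h3 : Real.exp 1 ^ 6 ≤ 404 :=
    le_trans (by gcongr) (by norm_num : (2.7182818286 : ℝ) ^ 6 ≤ 404)
  nlinarith [pow_nonneg (Real.exp_pos 1).le 6]

end Summit.QuantumFields.BalabanUV.T4Continuum.NE9LinSizeKP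

end
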